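import Mathlib
import HarnessLib

/-!
# Towards boundary uniqueness on the upper half-plane for `L¹_loc` traces — Part 1:
# the zero extension has vanishing rectangle integrals

Topic `Literature/Analysis/DeBrangesSpaces` (support file: theorems only). Let `D` be holomorphic
on the open upper half-plane, with the local majorant `‖D(x+iy)‖ ≤ C(1 + y^{−1/2})` on
`[a,b] × (0,Y]` (`hmaj`) and traces tending to zero in `L¹_loc`: `∫_a^b ‖D(x+iy)‖dx → 0` as
`y ↓ 0` (`htr`). Write `G = 1_{ℂ₊}·D` for the zero extension of `D` to `ℂ`.

* `rect_ext_eq_zero` — **`G` has vanishing rectangle integrals for EVERY rectangle** (any position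
  with respect to the real line): `∫_a^b G(x+iy₁) − ∫_a^b G(x+iy₂) + i∫_{y₁}^{y₂}G(b+is) −
  i∫_{y₁}^{y₂}G(a+is) = 0`. Above the line this is Cauchy–Goursat; across the line it follows from
  `potential_eq_zero` (Cauchy–Goursat on `[a,b] × [ε,y]` and `ε ↓ 0`, using the trace hypothesis
  and the continuity of the vertical primitives `∫₀ᵗ G(c+is)ds`, `integrableOn_vertical`).
* `integral_vertical_A`, `integral_horizontal_A` — the edge integrals of the vertical averages
  `A_h(z) = ∫₀ʰ G(z+it) dt` in terms of those of `G` (interval algebra for the vertical edges;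
  Fubini, `integral_horizontal_swap`, for the horizontal ones).

Part 2 (appended): `continuous_verticalPrimitive₂` / `continuous_verticalAverage` — `A_h` is
continuous on `ℂ` (dominated convergence for the vertical primitive, jointly in the base point);
`isConservativeOn_verticalAverage` — by Part 1 it is conservative; hence entire by Morera's theorem
(`Complex.IsConservativeOn.isExactOn_univ`); it vanishes below `Im z = −h`, hence identically, and
differentiating in `h` gives **`eq_zero_of_trace_tendsto_zero : D ≡ 0` on the upper half-plane**
— the uniqueness half of the gluing principle behind the continuation of model-space functions
across the real axis (Painlevé/Morera for non-continuous boundary behaviour). All statements are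
folklore.
-/

noncomputable section

namespace Literature.Analysis.DeBrangesSpaces

open _root_.MeasureTheory _root_.Complex Set Filter Metric intervalIntegral
open scoped Topology Real Interval

section Uniqueness

variable {D : ℂ → ℂ}

/-- The zero extension `G = 1_{ℂ₊}·D` is measurable when `D` is holomorphic on `ℂ₊`.
[cite: Rudin1987, Thm. 16.8 (Painlevé; proof)] -/
private theorem measurable_ext (hD : DifferentiableOn ℂ D {z : ℂ | 0 < z.im}) :
    Measurable ({z : ℂ | 0 < z.im}.indicator D) := by
  classical
  have hopen : IsOpen {z : ℂ | 0 < z.im} := isOpen_lt continuous_const Complex.continuous_im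
  rw [← Set.piecewise_eq_indicator]
  exact hD.continuousOn.measurable_piecewise continuousOn_const hopen.measurableSet

/-- The zero extension vanishes on the closed lower half-plane. [cite: Rudin1987, Thm. 16.8 (proof)] -/
private theorem ext_of_nonpos {z : ℂ} (hz : z.im ≤ 0) : ({z : ℂ | 0 < z.im}.indicator D) z = 0 :=
  indicator_of_notMem (by simpa using hz) _

/-- The zero extension agrees with `D` on the open upper half-plane. [cite: Rudin1987, Thm. 16.8 (proof)] -/
private theorem ext_of_pos {z : ℂ} (hz : 0 < z.im) : ({z : ℂ | 0 < z.im}.indicator D) z = D z :=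
  indicator_of_mem (show z ∈ {z : ℂ | 0 < z.im} from hz) _

/-- Vertical integrability of the zero extension: under the majorant
`‖D(x+iy)‖ ≤ C(1 + y^{−1/2})` on `(0,Y]`, `y ↦ G(c + iy)` is integrable on every `(−∞, Y]`.
[cite: Rudin1987, Thm. 16.8 (proof)] -/
theorem integrableOn_vertical (hD : DifferentiableOn ℂ D {z : ℂ | 0 < z.im})
    (hmaj : ∀ a b Y : ℝ, ∃ C : ℝ, ∀ x ∈ Icc a b, ∀ y : ℝ, 0 < y → y ≤ Y →
      ‖D (x + y * I)‖ ≤ C * (1 + y ^ (-(1 / 2 : ℝ))))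
    (c Y : ℝ) :
    IntegrableOn (fun y : ℝ ↦ ({z : ℂ | 0 < z.im}.indicator D) (c + y * I)) (Iic Y) := by
  obtain ⟨C, hC⟩ := hmaj c c Y
  -- the function is `(Ioi 0).indicator (y ↦ D (c + yI))`
  have heq : (fun y : ℝ ↦ ({z : ℂ | 0 < z.im}.indicator D) (c + y * I)) =
      (Ioi (0 : ℝ)).indicator fun y : ℝ ↦ D (c + y * I) := by
    funext y
    by_cases hy : 0 < y
    · rw [indicator_of_mem (show y ∈ Ioi (0 : ℝ) from hy), ext_of_pos (by simpa using hy)]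
    · rw [indicator_of_notMem (show y ∉ Ioi (0 : ℝ) from hy), ext_of_nonpos (by simpa using hy)]
  rw [heq, integrableOn_indicator_iff measurableSet_Ioi]
  -- on `(0, Y]`: majorant `C (1 + y^{-1/2})`
  have hcont : ContinuousOn (fun y : ℝ ↦ D (c + y * I)) (Ioi 0) := by
    refine hD.continuousOn.comp (by fun_prop : Continuous fun y : ℝ ↦ (c : ℂ) + y * I).continuousOn ?_
    intro y hy
    simpa using hy
  have hmeas : AEStronglyMeasurable (fun y : ℝ ↦ D (c + y * I)) (volume.restrict (Ioi 0 ∩ Iic Y)) :=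
    (hcont.mono inter_subset_left).aestronglyMeasurable (measurableSet_Ioi.inter measurableSet_Iic)
  have hsub : Ioi (0 : ℝ) ∩ Iic Y ⊆ Ι 0 Y := by
    rintro y ⟨h1, h2⟩
    have hY : 0 ≤ Y := h1.le.trans h2
    rw [uIoc_of_le hY]
    exact ⟨h1, h2⟩
  have hsub' : Ioi (0 : ℝ) ∩ Iic Y ⊆ Icc 0 Y := fun y hy ↦ ⟨hy.1.le, hy.2⟩
  have hmajint : IntegrableOn (fun y : ℝ ↦ C * (1 + y ^ (-(1 / 2 : ℝ)))) (Ioi 0 ∩ Iic Y) := by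
    have h1 : IntervalIntegrable (fun y : ℝ ↦ y ^ (-(1 / 2 : ℝ))) volume 0 Y :=
      intervalIntegral.intervalIntegrable_rpow' (by norm_num)
    have h2 : IntegrableOn (fun y : ℝ ↦ y ^ (-(1 / 2 : ℝ))) (Ioi 0 ∩ Iic Y) :=
      ((intervalIntegrable_iff.1 h1).mono_set hsub)
    have h3 : IntegrableOn (fun _ : ℝ ↦ (1 : ℝ)) (Ioi 0 ∩ Iic Y) :=
      (continuous_const.integrableOn_Icc).mono_set hsub'
    exact (h3.add h2).const_mul C
  refine Integrable.mono' hmajint hmeas ?_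
  filter_upwards [ae_restrict_mem (measurableSet_Ioi.inter measurableSet_Iic)] with y hy
  exact hC c (by simp) y hy.1 hy.2


/-- Interval integrability of the vertical sections of the zero extension. [cite: Rudin1987, Thm. 16.8 (proof)] -/
private theorem intervalIntegrable_vertical (hD : DifferentiableOn ℂ D {z : ℂ | 0 < z.im})
    (hmaj : ∀ a b Y : ℝ, ∃ C : ℝ, ∀ x ∈ Icc a b, ∀ y : ℝ, 0 < y → y ≤ Y →
      ‖D (x + y * I)‖ ≤ C * (1 + y ^ (-(1 / 2 : ℝ))))
    (c t₁ t₂ : ℝ) :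
    IntervalIntegrable (fun y : ℝ ↦ ({z : ℂ | 0 < z.im}.indicator D) (c + y * I)) volume t₁ t₂ := by
  rw [intervalIntegrable_iff]
  exact (integrableOn_vertical hD hmaj c (max t₁ t₂)).mono_set
    (uIoc_subset_uIcc.trans (uIcc_subset_Icc ⟨inf_le_left, le_sup_left⟩ ⟨inf_le_right, le_sup_right⟩)
      |>.trans fun y hy ↦ hy.2)

/-- The vertical primitive `P_c(t) = ∫₀ᵗ G(c + is) ds` is continuous. [cite: Rudin1987, Thm. 16.8 (proof)] -/
private theorem continuous_verticalPrimitive (hD : DifferentiableOn ℂ D {z : ℂ | 0 < z.im})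
    (hmaj : ∀ a b Y : ℝ, ∃ C : ℝ, ∀ x ∈ Icc a b, ∀ y : ℝ, 0 < y → y ≤ Y →
      ‖D (x + y * I)‖ ≤ C * (1 + y ^ (-(1 / 2 : ℝ))))
    (c : ℝ) :
    Continuous fun t : ℝ ↦ ∫ s in (0 : ℝ)..t, ({z : ℂ | 0 < z.im}.indicator D) (c + s * I) :=
  intervalIntegral.continuous_primitive (intervalIntegrable_vertical hD hmaj c) 0

/-- The vertical primitive vanishes at non-positive heights. [cite: Rudin1987, Thm. 16.8 (proof)] -/
private theorem verticalPrimitive_of_nonpos (c : ℝ) {t : ℝ} (ht : t ≤ 0) :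
    ∫ s in (0 : ℝ)..t, ({z : ℂ | 0 < z.im}.indicator D) (c + s * I) = 0 := by
  have h : EqOn (fun s : ℝ ↦ ({z : ℂ | 0 < z.im}.indicator D) (c + s * I)) (fun _ ↦ (0 : ℂ))
      (uIcc 0 t) := by
    intro s hs
    have hs' : s ≤ 0 := by
      have := hs.2
      rwa [max_eq_left ht] at this
    exact ext_of_nonpos (by simpa using hs')
  rw [intervalIntegral.integral_congr h, intervalIntegral.integral_zero]

/-- **The rectangle potential vanishes above the line**: for `y > 0`,
`−∫_a^b D(x+iy)dx + i∫₀ʸ G(b+is)ds − i∫₀ʸ G(a+is)ds = 0` (Cauchy–Goursat on `[a,b] × [ε,y]` and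
`ε ↓ 0`: the bottom edge tends to `0` by the trace hypothesis, the vertical primitives are
continuous at `0`). [cite: Rudin1987, Thm. 16.8 (proof)] -/
theorem potential_eq_zero (hD : DifferentiableOn ℂ D {z : ℂ | 0 < z.im})
    (hmaj : ∀ a b Y : ℝ, ∃ C : ℝ, ∀ x ∈ Icc a b, ∀ y : ℝ, 0 < y → y ≤ Y →
      ‖D (x + y * I)‖ ≤ C * (1 + y ^ (-(1 / 2 : ℝ))))
    (htr : ∀ a b : ℝ, Tendsto (fun y : ℝ ↦ ∫ x in a..b, ‖D (x + y * I)‖) (𝓝[>] 0) (𝓝 0))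
    (a b : ℝ) {y : ℝ} (hy : 0 < y) :
    -(∫ x in a..b, D (x + y * I)) +
        I • (∫ s in (0 : ℝ)..y, ({z : ℂ | 0 < z.im}.indicator D) (b + s * I)) -
        I • (∫ s in (0 : ℝ)..y, ({z : ℂ | 0 < z.im}.indicator D) (a + s * I)) = 0 := by
  set G : ℂ → ℂ := {z : ℂ | 0 < z.im}.indicator D with hG
  set Pa : ℝ → ℂ := fun t ↦ ∫ s in (0 : ℝ)..t, G (a + s * I) with hPa
  set Pb : ℝ → ℂ := fun t ↦ ∫ s in (0 : ℝ)..t, G (b + s * I) with hPb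
  have hPa_cont : Continuous Pa := continuous_verticalPrimitive hD hmaj a
  have hPb_cont : Continuous Pb := continuous_verticalPrimitive hD hmaj b
  have hPa0 : Pa 0 = 0 := by simp [hPa]
  have hPb0 : Pb 0 = 0 := by simp [hPb]
  -- Cauchy–Goursat on `[a,b] × [ε, y]` for `0 < ε < y`
  have hCG : ∀ ε : ℝ, 0 < ε → ε < y →
      (∫ x in a..b, D (x + ε * I)) - (∫ x in a..b, D (x + y * I)) +
        I • (Pb y - Pb ε) - I • (Pa y - Pa ε) = 0 := by
    intro ε hε hεy
    have hrect : ([[a, b]] ×ℂ [[ε, y]]) ⊆ {z : ℂ | 0 < z.im} := by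
      intro z hz
      have h2 : z.im ∈ [[ε, y]] := hz.2
      rw [uIcc_of_le hεy.le] at h2
      exact hε.trans_le h2.1
    have h := Complex.integral_boundary_rect_eq_zero_of_differentiableOn D (a + ε * I) (b + y * I)
      (hD.mono (by simpa using hrect))
    simp only [add_re, ofReal_re, mul_re, I_re, mul_zero, ofReal_im, I_im, mul_one, sub_self,
      add_zero, add_im, mul_im, zero_add] at h
    -- the vertical integrals of `D` over `[ε, y]` are those of `G`, i.e. `P(y) − P(ε)`
    have hvert : ∀ c : ℝ, ∫ s in ε..y, D (c + s * I) =
        (∫ s in (0 : ℝ)..y, G (c + s * I)) - ∫ s in (0 : ℝ)..ε, G (c + s * I) := by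
      intro c
      rw [intervalIntegral.integral_interval_sub_left (intervalIntegrable_vertical hD hmaj c 0 y)
        (intervalIntegrable_vertical hD hmaj c 0 ε)]
      refine intervalIntegral.integral_congr fun s hs ↦ ?_
      rw [uIcc_of_le hεy.le] at hs
      exact (ext_of_pos (by simpa using hε.trans_le hs.1)).symm
    rw [hvert b, hvert a] at h
    simpa [hPa, hPb] using h
  -- pass to the limit `ε → 0⁺`
  have hlim_bottom : Tendsto (fun ε : ℝ ↦ ∫ x in a..b, D (x + ε * I)) (𝓝[>] 0) (𝓝 0) := by
    rw [tendsto_zero_iff_norm_tendsto_zero]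
    refine squeeze_zero' (Eventually.of_forall fun ε ↦ norm_nonneg _)
      (Eventually.of_forall fun ε ↦ intervalIntegral.norm_integral_le_abs_integral_norm) ?_
    have := (htr a b).abs
    simpa using this
  have hlimPa : Tendsto Pa (𝓝[>] 0) (𝓝 0) := by
    rw [← hPa0]; exact (hPa_cont.tendsto 0).mono_left nhdsWithin_le_nhds
  have hlimPb : Tendsto Pb (𝓝[>] 0) (𝓝 0) := by
    rw [← hPb0]; exact (hPb_cont.tendsto 0).mono_left nhdsWithin_le_nhds
  have hlim : Tendsto (fun ε : ℝ ↦ (∫ x in a..b, D (x + ε * I)) - (∫ x in a..b, D (x + y * I)) +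
        I • (Pb y - Pb ε) - I • (Pa y - Pa ε)) (𝓝[>] 0)
      (𝓝 (0 - (∫ x in a..b, D (x + y * I)) + I • (Pb y - 0) - I • (Pa y - 0))) :=
    ((hlim_bottom.sub tendsto_const_nhds).add
      ((tendsto_const_nhds.sub hlimPb).const_smul I)).sub
      ((tendsto_const_nhds.sub hlimPa).const_smul I)
  have hzero : Tendsto (fun ε : ℝ ↦ (∫ x in a..b, D (x + ε * I)) - (∫ x in a..b, D (x + y * I)) +
        I • (Pb y - Pb ε) - I • (Pa y - Pa ε)) (𝓝[>] 0) (𝓝 0) := by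
    refine tendsto_const_nhds.congr' ?_
    have hev : ∀ᶠ ε : ℝ in 𝓝[>] 0, ε < y := by
      exact mem_nhdsWithin_of_mem_nhds (Iio_mem_nhds hy)
    filter_upwards [hev, self_mem_nhdsWithin] with ε h1 h2
    exact (hCG ε h2 h1).symm
  have := tendsto_nhds_unique hlim hzero
  simp only [zero_sub, sub_zero] at this
  rw [← this]

/-- **The zero extension has vanishing rectangle integrals** (all rectangles, any position with
respect to the real line): with `G = 1_{ℂ₊}D`,
`∫_a^b G(x+iy₁) − ∫_a^b G(x+iy₂) + i∫_{y₁}^{y₂} G(b+is) − i∫_{y₁}^{y₂} G(a+is) = 0`.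
[cite: Rudin1987, Thm. 16.8 (proof)] -/
theorem rect_ext_eq_zero (hD : DifferentiableOn ℂ D {z : ℂ | 0 < z.im})
    (hmaj : ∀ a b Y : ℝ, ∃ C : ℝ, ∀ x ∈ Icc a b, ∀ y : ℝ, 0 < y → y ≤ Y →
      ‖D (x + y * I)‖ ≤ C * (1 + y ^ (-(1 / 2 : ℝ))))
    (htr : ∀ a b : ℝ, Tendsto (fun y : ℝ ↦ ∫ x in a..b, ‖D (x + y * I)‖) (𝓝[>] 0) (𝓝 0))
    (a b y₁ y₂ : ℝ) :
    (∫ x in a..b, ({z : ℂ | 0 < z.im}.indicator D) (x + y₁ * I)) -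
        (∫ x in a..b, ({z : ℂ | 0 < z.im}.indicator D) (x + y₂ * I)) +
        I • (∫ s in y₁..y₂, ({z : ℂ | 0 < z.im}.indicator D) (b + s * I)) -
        I • (∫ s in y₁..y₂, ({z : ℂ | 0 < z.im}.indicator D) (a + s * I)) = 0 := by
  set G : ℂ → ℂ := {z : ℂ | 0 < z.im}.indicator D with hG
  -- the potential `R(y) = −∫_a^b G(x+iy) + i P_b(y) − i P_a(y)` vanishes identically
  set R : ℝ → ℂ := fun y ↦ -(∫ x in a..b, G (x + y * I)) +
      I • (∫ s in (0 : ℝ)..y, G (b + s * I)) - I • (∫ s in (0 : ℝ)..y, G (a + s * I)) with hR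
  have hR0 : ∀ y : ℝ, R y = 0 := by
    intro y
    rcases lt_or_ge 0 y with hy | hy
    · have htop : ∫ x in a..b, G (x + y * I) = ∫ x in a..b, D (x + y * I) :=
        intervalIntegral.integral_congr fun x _ ↦ ext_of_pos (by simpa using hy)
      rw [hR]
      simp only
      rw [htop]
      exact potential_eq_zero hD hmaj htr a b hy
    · have htop : ∫ x in a..b, G (x + y * I) = 0 := by
        rw [intervalIntegral.integral_congr (g := fun _ ↦ (0 : ℂ)) (fun x _ ↦ ext_of_nonpos
          (by simpa using hy)), intervalIntegral.integral_zero]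
      rw [hR]
      simp only
      rw [htop, verticalPrimitive_of_nonpos b hy, verticalPrimitive_of_nonpos a hy]
      simp
  -- `∫_{y₁}^{y₂} = P(y₂) − P(y₁)`
  have hsplit : ∀ c : ℝ, ∫ s in y₁..y₂, G (c + s * I) =
      (∫ s in (0 : ℝ)..y₂, G (c + s * I)) - ∫ s in (0 : ℝ)..y₁, G (c + s * I) := fun c ↦
    (intervalIntegral.integral_interval_sub_left (intervalIntegrable_vertical hD hmaj c 0 y₂)
      (intervalIntegrable_vertical hD hmaj c 0 y₁)).symm
  have h1 := hR0 y₁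
  have h2 := hR0 y₂
  rw [hR] at h1 h2
  simp only at h1 h2
  rw [hsplit b, hsplit a]
  linear_combination h2 - h1

/-! ### The vertical averages `A_h(z) = ∫₀ʰ G(z + it) dt` -/

/-- The majorant `k(u) = C₊(1 + (u₊)^{−1/2})` (`C₊ = max C 0`, `u₊ = max u 0`) is integrable on
bounded intervals. [cite: Rudin1987, Thm. 16.8 (proof)] -/
private theorem intervalIntegrable_majorant (C α β : ℝ) :
    IntervalIntegrable (fun u : ℝ ↦ max C 0 * (1 + (max u 0) ^ (-(1 / 2 : ℝ)))) volume α β := by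
  have hk : ∀ u : ℝ, (max u 0) ^ (-(1 / 2 : ℝ)) = (Ioi (0 : ℝ)).indicator (fun u : ℝ ↦ u ^ (-(1 / 2 : ℝ))) u := by
    intro u
    by_cases hu : 0 < u
    · rw [max_eq_left hu.le, indicator_of_mem (show u ∈ Ioi (0 : ℝ) from hu)]
    · rw [max_eq_right (not_lt.1 hu), indicator_of_notMem (show u ∉ Ioi (0 : ℝ) from hu),
        Real.zero_rpow (by norm_num)]
  simp_rw [hk]
  refine (intervalIntegrable_const.add ?_).const_mul _
  rw [intervalIntegrable_iff, integrableOn_indicator_iff measurableSet_Ioi]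
  have h1 : IntervalIntegrable (fun u : ℝ ↦ u ^ (-(1 / 2 : ℝ))) volume 0 (max α β) :=
    intervalIntegral.intervalIntegrable_rpow' (by norm_num)
  refine ((intervalIntegrable_iff.1 h1).mono_set ?_)
  rintro u ⟨hu, hu'⟩
  have hu0 : 0 < u := hu
  have hle : u ≤ max α β := (uIoc_subset_uIcc hu').2
  rw [uIoc_of_le (hu0.le.trans hle)]
  exact ⟨hu0, hle⟩

/-- The pointwise majorant of the zero extension on a vertical strip: for `x ∈ [a,b]` and
`u ≤ Y`, `‖G(x + iu)‖ ≤ C₊(1 + (u₊)^{−1/2})` with the constant of `hmaj a b Y`.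
[cite: Rudin1987, Thm. 16.8 (proof)] -/
private theorem norm_ext_le {C a b Y : ℝ}
    (hC : ∀ x ∈ Icc a b, ∀ y : ℝ, 0 < y → y ≤ Y → ‖D (x + y * I)‖ ≤ C * (1 + y ^ (-(1 / 2 : ℝ))))
    {x u : ℝ} (hx : x ∈ Icc a b) (hu : u ≤ Y) :
    ‖({z : ℂ | 0 < z.im}.indicator D) (x + u * I)‖ ≤ max C 0 * (1 + (max u 0) ^ (-(1 / 2 : ℝ))) := by
  rcases le_or_gt u 0 with h0 | h0
  · rw [ext_of_nonpos (by simpa using h0), norm_zero]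
    positivity
  · rw [ext_of_pos (by simpa using h0), max_eq_left h0.le]
    exact (hC x hx u h0 hu).trans (mul_le_mul_of_nonneg_right (le_max_left _ _) (by positivity))

/-- Integrability of `(x,t) ↦ G(x + i(y+t))` on `(a,b] × (0,h]`. [cite: Rudin1987, Thm. 16.8 (proof)] -/
private theorem integrable_prod_horizontal (hD : DifferentiableOn ℂ D {z : ℂ | 0 < z.im})
    (hmaj : ∀ a b Y : ℝ, ∃ C : ℝ, ∀ x ∈ Icc a b, ∀ y : ℝ, 0 < y → y ≤ Y →
      ‖D (x + y * I)‖ ≤ C * (1 + y ^ (-(1 / 2 : ℝ))))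
    (a b y h : ℝ) :
    Integrable (fun p : ℝ × ℝ ↦ ({z : ℂ | 0 < z.im}.indicator D) (p.1 + (y + p.2) * I))
      ((volume.restrict (Ι a b)).prod (volume.restrict (Ι 0 h))) := by
  obtain ⟨C, hC⟩ := hmaj (min a b) (max a b) (y + max 0 h)
  have hGm : Measurable ({z : ℂ | 0 < z.im}.indicator D) := measurable_ext hD
  have hmeas : AEStronglyMeasurable
      (fun p : ℝ × ℝ ↦ ({z : ℂ | 0 < z.im}.indicator D) (p.1 + (y + p.2) * I))
      ((volume.restrict (Ι a b)).prod (volume.restrict (Ι 0 h))) := by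
    refine (hGm.comp ?_).aestronglyMeasurable
    exact (Complex.measurable_ofReal.comp measurable_fst).add
      (((measurable_const.add (Complex.measurable_ofReal.comp measurable_snd))).mul measurable_const)
  -- majorant `1 · k(y + t)`
  have hk : Integrable (fun t : ℝ ↦ max C 0 * (1 + (max (y + t) 0) ^ (-(1 / 2 : ℝ))))
      (volume.restrict (Ι 0 h)) := by
    have h2 : IntervalIntegrable (fun t : ℝ ↦ max C 0 * (1 + (max (y + t) 0) ^ (-(1 / 2 : ℝ))))
        volume 0 h := by
      convert (intervalIntegrable_majorant C y (y + h)).comp_add_left y using 2 <;> simp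
    exact (intervalIntegrable_iff.1 h2)
  haveI : IsFiniteMeasure ((volume : Measure ℝ).restrict (Ι a b)) := by
    rw [uIoc]; infer_instance
  have hone : Integrable (fun _ : ℝ ↦ (1 : ℝ)) (volume.restrict (Ι a b)) :=
    integrable_const _
  refine Integrable.mono' (hone.mul_prod hk) hmeas ?_
  rw [Measure.prod_restrict, ae_restrict_iff' (measurableSet_uIoc.prod measurableSet_uIoc)]
  refine ae_of_all _ fun p hp ↦ ?_
  obtain ⟨hp1, hp2⟩ := hp
  rw [one_mul]
  have hx : p.1 ∈ Icc (min a b) (max a b) := ⟨(uIoc_subset_uIcc hp1).1, (uIoc_subset_uIcc hp1).2⟩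
  have ht : y + p.2 ≤ y + max 0 h := by
    have := (uIoc_subset_uIcc hp2).2
    linarith [this]
  have := norm_ext_le hC hx ht
  simpa [add_assoc] using this

/-- Fubini for the horizontal edges: `∫_a^b A_h(x + iy) dx = ∫₀ʰ ∫_a^b G(x + i(y+t)) dx dt`.
[cite: Rudin1987, Thm. 16.8 (proof)] -/
private theorem integral_horizontal_swap (hD : DifferentiableOn ℂ D {z : ℂ | 0 < z.im})
    (hmaj : ∀ a b Y : ℝ, ∃ C : ℝ, ∀ x ∈ Icc a b, ∀ y : ℝ, 0 < y → y ≤ Y →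
      ‖D (x + y * I)‖ ≤ C * (1 + y ^ (-(1 / 2 : ℝ))))
    (a b y h : ℝ) :
    ∫ x in a..b, ∫ t in (0 : ℝ)..h, ({z : ℂ | 0 < z.im}.indicator D) (x + (y + t) * I) =
      ∫ t in (0 : ℝ)..h, ∫ x in a..b, ({z : ℂ | 0 < z.im}.indicator D) (x + (y + t) * I) := by
  have hI : Integrable (Function.uncurry fun x t : ℝ ↦
      ({z : ℂ | 0 < z.im}.indicator D) (x + (y + t) * I))
      ((volume.restrict (Ι a b)).prod (volume.restrict (Ι 0 h))) :=
    integrable_prod_horizontal hD hmaj a b y h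
  have hswap := MeasureTheory.integral_integral_swap hI
  set F : ℝ → ℝ → ℂ := fun x t ↦ ({z : ℂ | 0 < z.im}.indicator D) (x + (y + t) * I) with hF
  set c₁ : ℝ := if a ≤ b then 1 else -1 with hc₁
  set c₂ : ℝ := if (0 : ℝ) ≤ h then 1 else -1 with hc₂
  calc ∫ x in a..b, ∫ t in (0 : ℝ)..h, F x t
      = c₁ • ∫ x in Ι a b, (c₂ • ∫ t in Ι 0 h, F x t) := by
        simp only [intervalIntegral.intervalIntegral_eq_integral_uIoc, hc₁, hc₂]
    _ = c₁ • c₂ • ∫ x in Ι a b, ∫ t in Ι 0 h, F x t := by rw [MeasureTheory.integral_smul]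
    _ = c₁ • c₂ • ∫ t in Ι 0 h, ∫ x in Ι a b, F x t := by rw [hswap]
    _ = c₂ • ∫ t in Ι 0 h, (c₁ • ∫ x in Ι a b, F x t) := by
        rw [MeasureTheory.integral_smul, smul_comm]
    _ = ∫ t in (0 : ℝ)..h, ∫ x in a..b, F x t := by
        simp only [intervalIntegral.intervalIntegral_eq_integral_uIoc, hc₁, hc₂]

/-- The vertical sections of `A_h`: `A_h(c + is) = P_c(s + h) − P_c(s)`. [cite: Rudin1987, Thm. 16.8 (proof)] -/
theorem A_vertical_eq (hD : DifferentiableOn ℂ D {z : ℂ | 0 < z.im})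
    (hmaj : ∀ a b Y : ℝ, ∃ C : ℝ, ∀ x ∈ Icc a b, ∀ y : ℝ, 0 < y → y ≤ Y →
      ‖D (x + y * I)‖ ≤ C * (1 + y ^ (-(1 / 2 : ℝ))))
    (c s h : ℝ) :
    ∫ t in (0 : ℝ)..h, ({z : ℂ | 0 < z.im}.indicator D) ((c : ℂ) + s * I + t * I) =
      (∫ σ in (0 : ℝ)..(s + h), ({z : ℂ | 0 < z.im}.indicator D) (c + σ * I)) -
        ∫ σ in (0 : ℝ)..s, ({z : ℂ | 0 < z.im}.indicator D) (c + σ * I) := by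
  have h1 : ∫ t in (0 : ℝ)..h, ({z : ℂ | 0 < z.im}.indicator D) ((c : ℂ) + s * I + t * I) =
      ∫ t in (0 : ℝ)..h, (fun σ : ℝ ↦ ({z : ℂ | 0 < z.im}.indicator D) (c + σ * I)) (t + s) := by
    refine intervalIntegral.integral_congr fun t _ ↦ ?_
    simp only
    congr 1
    push_cast
    ring
  rw [h1, intervalIntegral.integral_comp_add_right (fun σ : ℝ ↦
      ({z : ℂ | 0 < z.im}.indicator D) (c + σ * I)) s, zero_add,
    intervalIntegral.integral_interval_sub_left (intervalIntegrable_vertical hD hmaj c _ _)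
      (intervalIntegrable_vertical hD hmaj c _ _), add_comm]

/-- The vertical edges of `A_h`: `∫_{y₁}^{y₂} A_h(c + is) ds = ∫₀ʰ (P_c(y₂ + t) − P_c(y₁ + t)) dt`
(interval algebra for the continuous primitive `P_c`; no Fubini). [cite: Rudin1987, Thm. 16.8 (proof)] -/
theorem integral_vertical_A (hD : DifferentiableOn ℂ D {z : ℂ | 0 < z.im})
    (hmaj : ∀ a b Y : ℝ, ∃ C : ℝ, ∀ x ∈ Icc a b, ∀ y : ℝ, 0 < y → y ≤ Y →
      ‖D (x + y * I)‖ ≤ C * (1 + y ^ (-(1 / 2 : ℝ))))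
    (c y₁ y₂ h : ℝ) :
    ∫ s in y₁..y₂, ∫ t in (0 : ℝ)..h, ({z : ℂ | 0 < z.im}.indicator D) ((c : ℂ) + s * I + t * I) =
      ∫ t in (0 : ℝ)..h,
        ((∫ σ in (0 : ℝ)..(y₂ + t), ({z : ℂ | 0 < z.im}.indicator D) (c + σ * I)) -
          ∫ σ in (0 : ℝ)..(y₁ + t), ({z : ℂ | 0 < z.im}.indicator D) (c + σ * I)) := by
  set P : ℝ → ℂ := fun τ ↦ ∫ σ in (0 : ℝ)..τ, ({z : ℂ | 0 < z.im}.indicator D) (c + σ * I) with hP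
  have hPc : Continuous P := continuous_verticalPrimitive hD hmaj c
  have hPi : ∀ α β : ℝ, IntervalIntegrable P volume α β := fun α β ↦
    (hPc.intervalIntegrable α β)
  simp_rw [A_vertical_eq hD hmaj]
  change ∫ s in y₁..y₂, (P (s + h) - P s) = ∫ t in (0 : ℝ)..h, (P (y₂ + t) - P (y₁ + t))
  have hi1 : IntervalIntegrable (fun s : ℝ ↦ P (s + h)) volume y₁ y₂ :=
    (hPc.comp (continuous_id.add continuous_const)).intervalIntegrable _ _
  have hi2 : IntervalIntegrable (fun t : ℝ ↦ P (y₂ + t)) volume 0 h :=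
    (hPc.comp (continuous_const.add continuous_id)).intervalIntegrable _ _
  have hi3 : IntervalIntegrable (fun t : ℝ ↦ P (y₁ + t)) volume 0 h :=
    (hPc.comp (continuous_const.add continuous_id)).intervalIntegrable _ _
  rw [intervalIntegral.integral_sub hi1 (hPi _ _), intervalIntegral.integral_sub hi2 hi3,
    intervalIntegral.integral_comp_add_right P h]
  have e2 : ∫ t in (0 : ℝ)..h, P (y₂ + t) = ∫ u in y₂..y₂ + h, P u := by
    have := intervalIntegral.integral_comp_add_right (fun t ↦ P t) y₂ (a := 0) (b := h)
    simp only [zero_add] at this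
    rw [show y₂ + h = h + y₂ by ring, ← this]
    exact intervalIntegral.integral_congr fun t _ ↦ by simp only [add_comm]
  have e1 : ∫ t in (0 : ℝ)..h, P (y₁ + t) = ∫ u in y₁..y₁ + h, P u := by
    have := intervalIntegral.integral_comp_add_right (fun t ↦ P t) y₁ (a := 0) (b := h)
    simp only [zero_add] at this
    rw [show y₁ + h = h + y₁ by ring, ← this]
    exact intervalIntegral.integral_congr fun t _ ↦ by simp only [add_comm]
  rw [e2, e1]
  have h3 := intervalIntegral.integral_add_adjacent_intervals (hPi (y₁ + h) y₁) (hPi y₁ (y₂ + h))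
  have h4 := intervalIntegral.integral_add_adjacent_intervals (hPi y₁ y₂) (hPi y₂ (y₂ + h))
  have h5 := intervalIntegral.integral_symm (μ := volume) (f := P) y₁ (y₁ + h)
  linear_combination -h3 - h4 + h5

/-- The horizontal edges of `A_h` (Fubini). [cite: Rudin1987, Thm. 16.8 (proof)] -/
theorem integral_horizontal_A (hD : DifferentiableOn ℂ D {z : ℂ | 0 < z.im})
    (hmaj : ∀ a b Y : ℝ, ∃ C : ℝ, ∀ x ∈ Icc a b, ∀ y : ℝ, 0 < y → y ≤ Y →
      ‖D (x + y * I)‖ ≤ C * (1 + y ^ (-(1 / 2 : ℝ))))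
    (a b y h : ℝ) :
    ∫ x in a..b, ∫ t in (0 : ℝ)..h, ({z : ℂ | 0 < z.im}.indicator D) ((x : ℂ) + y * I + t * I) =
      ∫ t in (0 : ℝ)..h, ∫ x in a..b, ({z : ℂ | 0 < z.im}.indicator D) (x + (y + t) * I) := by
  rw [← integral_horizontal_swap hD hmaj a b y h]
  refine intervalIntegral.integral_congr fun x _ ↦ intervalIntegral.integral_congr fun t _ ↦ ?_
  show _ = ({z : ℂ | 0 < z.im}.indicator D) ((x : ℂ) + (y + t) * I)
  congr 1
  ring

/-! ### Part 2 (appended): continuity of the vertical averages, Morera, and the uniqueness theorem -/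

/-- **Joint continuity of the vertical primitive** `(x, s) ↦ ∫₀ˢ G(x + iσ) dσ` (dominated
convergence in `x` with the majorant `2C₊(1 + σ₊^{−1/2})` on `Ι (−S) S`, continuity in `s`).
[cite: Rudin1987, Thm. 16.8 (proof)] -/
theorem continuous_verticalPrimitive₂ (hD : DifferentiableOn ℂ D {z : ℂ | 0 < z.im})
    (hmaj : ∀ a b Y : ℝ, ∃ C : ℝ, ∀ x ∈ Icc a b, ∀ y : ℝ, 0 < y → y ≤ Y →
      ‖D (x + y * I)‖ ≤ C * (1 + y ^ (-(1 / 2 : ℝ)))) :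
    Continuous fun p : ℝ × ℝ ↦
      ∫ σ in (0 : ℝ)..p.2, ({z : ℂ | 0 < z.im}.indicator D) (p.1 + σ * I) := by
  set G : ℂ → ℂ := {z : ℂ | 0 < z.im}.indicator D with hG
  have hGm : Measurable G := measurable_ext hD
  rw [continuous_iff_continuousAt]
  rintro ⟨x₀, s₀⟩
  set S : ℝ := |s₀| + 1 with hS
  obtain ⟨C, hC⟩ := hmaj (x₀ - 1) (x₀ + 1) S
  -- `M(x) := ∫_{Ι (−S) S} ‖G(x+iσ) − G(x₀+iσ)‖ dσ → 0` as `x → x₀` (dominated convergence)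
  have hM : Tendsto (fun x : ℝ ↦ ∫ σ in Ι (-S) S, ‖G (x + σ * I) - G (x₀ + σ * I)‖)
      (𝓝 x₀) (𝓝 0) := by
    have hbound_int : Integrable (fun σ : ℝ ↦ 2 * (max C 0 * (1 + (max σ 0) ^ (-(1 / 2 : ℝ)))))
        ((volume : Measure ℝ).restrict (Ι (-S) S)) :=
      ((intervalIntegrable_iff.1 (intervalIntegrable_majorant C (-S) S)).const_mul 2)
    have hlim := MeasureTheory.tendsto_integral_filter_of_dominated_convergence
      (μ := (volume : Measure ℝ).restrict (Ι (-S) S)) (l := 𝓝 x₀)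
      (F := fun x σ ↦ ‖G (x + σ * I) - G (x₀ + σ * I)‖) (f := fun _ ↦ (0 : ℝ))
      (fun σ ↦ 2 * (max C 0 * (1 + (max σ 0) ^ (-(1 / 2 : ℝ))))) ?_ ?_ hbound_int ?_
    · simpa using hlim
    · refine Eventually.of_forall fun x ↦ ?_
      have hm : Measurable fun σ : ℝ ↦ G (x + σ * I) - G (x₀ + σ * I) :=
        (hGm.comp (by fun_prop : Measurable fun σ : ℝ ↦ (x : ℂ) + σ * I)).sub
          (hGm.comp (by fun_prop : Measurable fun σ : ℝ ↦ (x₀ : ℂ) + σ * I))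
      exact hm.norm.aestronglyMeasurable
    · have hev : ∀ᶠ x : ℝ in 𝓝 x₀, x ∈ Icc (x₀ - 1) (x₀ + 1) :=
        Icc_mem_nhds (by linarith) (by linarith)
      filter_upwards [hev] with x hx
      refine (ae_restrict_iff' measurableSet_uIoc).2 (ae_of_all _ fun σ hσ ↦ ?_)
      have hσS : σ ≤ S := by
        have := (uIoc_subset_uIcc hσ).2
        rwa [max_eq_right (by rw [hS]; linarith [abs_nonneg s₀] : -S ≤ S)] at this
      have h1 := norm_ext_le hC hx hσS
      have h2 := norm_ext_le hC (x := x₀) ⟨by linarith, by linarith⟩ hσS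
      rw [Real.norm_eq_abs, abs_of_nonneg (norm_nonneg _)]
      calc ‖G (x + σ * I) - G (x₀ + σ * I)‖ ≤ ‖G (x + σ * I)‖ + ‖G (x₀ + σ * I)‖ := norm_sub_le _ _
        _ ≤ _ := by linarith
    · refine ae_of_all _ fun σ ↦ ?_
      rcases le_or_gt σ 0 with hσ | hσ
      · have : ∀ x : ℝ, G (x + σ * I) = 0 := fun x ↦ ext_of_nonpos (by simpa using hσ)
        simp only [this, sub_self, norm_zero]
        exact tendsto_const_nhds
      · have hcont : ContinuousAt (fun x : ℝ ↦ G (x + σ * I)) x₀ := by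
          have hopen : IsOpen {z : ℂ | 0 < z.im} := isOpen_lt continuous_const Complex.continuous_im
          have hz : (x₀ : ℂ) + σ * I ∈ {z : ℂ | 0 < z.im} := by
            show 0 < ((x₀ : ℂ) + σ * I).im; simpa using hσ
          have hDc : ContinuousAt D ((x₀ : ℂ) + σ * I) := (hD.differentiableAt (hopen.mem_nhds hz)).continuousAt
          have hGc : ContinuousAt G ((x₀ : ℂ) + σ * I) := by
            refine hDc.congr_of_eventuallyEq ?_
            filter_upwards [hopen.mem_nhds hz] with w hw
            exact ext_of_pos hw
          exact ContinuousAt.comp (f := fun x : ℝ ↦ (x : ℂ) + σ * I) hGc (Continuous.continuousAt (by fun_prop))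
        have := ((hcont.sub_const (G (x₀ + σ * I))).norm)
        rw [sub_self, norm_zero] at this
        exact this
  -- continuity of `P_{x₀}`
  have hP₀ : Continuous fun t : ℝ ↦ ∫ σ in (0 : ℝ)..t, G (x₀ + σ * I) :=
    continuous_verticalPrimitive hD hmaj x₀
  -- assemble
  rw [ContinuousAt, tendsto_iff_norm_sub_tendsto_zero]
  have hevS : ∀ᶠ p : ℝ × ℝ in 𝓝 (x₀, s₀), |p.2| < S := by
    have : ∀ᶠ s : ℝ in 𝓝 s₀, |s| < S := by
      refine (continuous_abs.tendsto s₀).eventually (Iio_mem_nhds ?_)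
      rw [hS]; linarith
    exact (continuous_snd.tendsto (x₀, s₀)).eventually this
  refine squeeze_zero_norm' ?_ ?_ (a := fun p : ℝ × ℝ ↦
    (∫ σ in Ι (-S) S, ‖G (p.1 + σ * I) - G (x₀ + σ * I)‖) +
      ‖(∫ σ in (0 : ℝ)..p.2, G (x₀ + σ * I)) - ∫ σ in (0 : ℝ)..s₀, G (x₀ + σ * I)‖)
  · filter_upwards [hevS] with p hp
    rw [norm_norm]
    have hsplit : (∫ σ in (0 : ℝ)..p.2, G (p.1 + σ * I)) - (∫ σ in (0 : ℝ)..s₀, G (x₀ + σ * I)) =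
        (∫ σ in (0 : ℝ)..p.2, (G (p.1 + σ * I) - G (x₀ + σ * I))) +
          ((∫ σ in (0 : ℝ)..p.2, G (x₀ + σ * I)) - ∫ σ in (0 : ℝ)..s₀, G (x₀ + σ * I)) := by
      rw [intervalIntegral.integral_sub (intervalIntegrable_vertical hD hmaj p.1 0 p.2)
        (intervalIntegrable_vertical hD hmaj x₀ 0 p.2)]
      ring
    rw [hsplit]
    refine (norm_add_le _ _).trans (add_le_add ?_ le_rfl)
    calc ‖∫ σ in (0 : ℝ)..p.2, (G (p.1 + σ * I) - G (x₀ + σ * I))‖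
        ≤ ∫ σ in Ι 0 p.2, ‖G (p.1 + σ * I) - G (x₀ + σ * I)‖ :=
          intervalIntegral.norm_integral_le_integral_norm_uIoc
      _ ≤ ∫ σ in Ι (-S) S, ‖G (p.1 + σ * I) - G (x₀ + σ * I)‖ := by
          refine setIntegral_mono_set ?_ (ae_of_all _ fun σ ↦ norm_nonneg _) (ae_of_all _ ?_)
          · exact ((intervalIntegrable_iff.1 (intervalIntegrable_vertical hD hmaj p.1 (-S) S)).sub
              (intervalIntegrable_iff.1 (intervalIntegrable_vertical hD hmaj x₀ (-S) S))).norm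
          · intro σ hσ
            have hSpos : 0 < S := by rw [hS]; positivity
            rw [uIoc_of_le (by linarith : -S ≤ S)]
            have h1 := (uIoc_subset_uIcc hσ)
            rcases le_or_gt 0 p.2 with h0 | h0
            · rw [uIoc_of_le h0] at hσ
              exact ⟨by linarith [hσ.1], by linarith [hσ.2, (abs_lt.1 hp).2]⟩
            · rw [uIoc_of_ge h0.le] at hσ
              exact ⟨by linarith [hσ.1, (abs_lt.1 hp).1], by linarith [hσ.2]⟩
  · have h1 : Tendsto (fun p : ℝ × ℝ ↦ ∫ σ in Ι (-S) S, ‖G (p.1 + σ * I) - G (x₀ + σ * I)‖)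
        (𝓝 (x₀, s₀)) (𝓝 0) := hM.comp (continuous_fst.tendsto (x₀, s₀))
    have h2 : Tendsto (fun p : ℝ × ℝ ↦
        ‖(∫ σ in (0 : ℝ)..p.2, G (x₀ + σ * I)) - ∫ σ in (0 : ℝ)..s₀, G (x₀ + σ * I)‖)
        (𝓝 (x₀, s₀)) (𝓝 0) := by
      have := ((hP₀.tendsto s₀).comp (continuous_snd.tendsto (x₀, s₀))).sub_const
        (∫ σ in (0 : ℝ)..s₀, G (x₀ + σ * I))
      rw [sub_self] at this
      simpa using this.norm
    simpa using h1.add h2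

/-- **The vertical averages `A_h(z) = ∫₀ʰ G(z+it)dt` are continuous on `ℂ`.** [cite: Rudin1987, Thm. 16.8 (proof)] -/
theorem continuous_verticalAverage (hD : DifferentiableOn ℂ D {z : ℂ | 0 < z.im})
    (hmaj : ∀ a b Y : ℝ, ∃ C : ℝ, ∀ x ∈ Icc a b, ∀ y : ℝ, 0 < y → y ≤ Y →
      ‖D (x + y * I)‖ ≤ C * (1 + y ^ (-(1 / 2 : ℝ))))
    (h : ℝ) :
    Continuous fun z : ℂ ↦ ∫ t in (0 : ℝ)..h, ({z : ℂ | 0 < z.im}.indicator D) (z + t * I) := by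
  set F : ℝ × ℝ → ℂ := fun p ↦ ∫ σ in (0 : ℝ)..p.2, ({z : ℂ | 0 < z.im}.indicator D) (p.1 + σ * I)
    with hF
  have hFc : Continuous F := continuous_verticalPrimitive₂ hD hmaj
  have heq : (fun z : ℂ ↦ ∫ t in (0 : ℝ)..h, ({z : ℂ | 0 < z.im}.indicator D) (z + t * I)) =
      fun z : ℂ ↦ F (z.re, z.im + h) - F (z.re, z.im) := by
    funext z
    have hz : z = (z.re : ℂ) + z.im * I := (Complex.re_add_im z).symm
    conv_lhs => rw [hz]
    rw [A_vertical_eq hD hmaj z.re z.im h]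
  rw [heq]
  exact (hFc.comp (Complex.continuous_re.prodMk (Complex.continuous_im.add continuous_const))).sub
    (hFc.comp (Complex.continuous_re.prodMk Complex.continuous_im))

/-- **The vertical averages are conservative on `ℂ`** (rectangle integrals of `G` vanish for every
rectangle, and `A_h`'s edge integrals are averages of those). [cite: Rudin1987, Thm. 16.8 (proof)] -/
theorem isConservativeOn_verticalAverage (hD : DifferentiableOn ℂ D {z : ℂ | 0 < z.im})
    (hmaj : ∀ a b Y : ℝ, ∃ C : ℝ, ∀ x ∈ Icc a b, ∀ y : ℝ, 0 < y → y ≤ Y →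
      ‖D (x + y * I)‖ ≤ C * (1 + y ^ (-(1 / 2 : ℝ))))
    (htr : ∀ a b : ℝ, Tendsto (fun y : ℝ ↦ ∫ x in a..b, ‖D (x + y * I)‖) (𝓝[>] 0) (𝓝 0))
    (h : ℝ) :
    Complex.IsConservativeOn
      (fun z : ℂ ↦ ∫ t in (0 : ℝ)..h, ({z : ℂ | 0 < z.im}.indicator D) (z + t * I)) univ := by
  set G : ℂ → ℂ := {z : ℂ | 0 < z.im}.indicator D with hG
  set A : ℂ → ℂ := fun z ↦ ∫ t in (0 : ℝ)..h, G (z + t * I) with hA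
  intro z w _
  have hsum := Complex.wedgeIntegral_add_wedgeIntegral_eq z w A
  suffices hzero : (∫ x in z.re..w.re, A (x + z.im * I)) - (∫ x in z.re..w.re, A (x + w.im * I)) +
      I • (∫ y in z.im..w.im, A (w.re + y * I)) - I • (∫ y in z.im..w.im, A (z.re + y * I)) = 0 by
    rw [hzero] at hsum
    exact eq_neg_of_add_eq_zero_left hsum
  set a := z.re; set b := w.re; set y₁ := z.im; set y₂ := w.im
  set Pa : ℝ → ℂ := fun τ ↦ ∫ σ in (0 : ℝ)..τ, G (a + σ * I) with hPa
  set Pb : ℝ → ℂ := fun τ ↦ ∫ σ in (0 : ℝ)..τ, G (b + σ * I) with hPb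
  set H : ℝ → ℂ := fun y ↦ ∫ x in a..b, G (x + y * I) with hH
  -- the four edges in terms of `G`
  have e1 : ∫ x in a..b, A (x + y₁ * I) = ∫ t in (0 : ℝ)..h, H (y₁ + t) := by
    simpa [hH, hA, Complex.ofReal_add] using integral_horizontal_A hD hmaj a b y₁ h
  have e2 : ∫ x in a..b, A (x + y₂ * I) = ∫ t in (0 : ℝ)..h, H (y₂ + t) := by
    simpa [hH, hA, Complex.ofReal_add] using integral_horizontal_A hD hmaj a b y₂ h
  have e3 : ∫ y in y₁..y₂, A (b + y * I) = ∫ t in (0 : ℝ)..h, (Pb (y₂ + t) - Pb (y₁ + t)) :=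
    integral_vertical_A hD hmaj b y₁ y₂ h
  have e4 : ∫ y in y₁..y₂, A (a + y * I) = ∫ t in (0 : ℝ)..h, (Pa (y₂ + t) - Pa (y₁ + t)) :=
    integral_vertical_A hD hmaj a y₁ y₂ h
  -- integrability in `t`
  have hPac : Continuous Pa := continuous_verticalPrimitive hD hmaj a
  have hPbc : Continuous Pb := continuous_verticalPrimitive hD hmaj b
  have hHint : ∀ y : ℝ, IntervalIntegrable (fun t : ℝ ↦ H (y + t)) volume 0 h := by
    intro y
    have hI := integrable_prod_horizontal hD hmaj a b y h
    have h2 := hI.integral_prod_right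
    -- `H (y+t) = c₁ • ∫ x in Ι a b, G (x + (y+t) I)`
    rw [intervalIntegrable_iff]
    refine (h2.smul (if a ≤ b then (1 : ℝ) else -1)).congr ?_
    refine ae_of_all _ fun t ↦ ?_
    simp only [hH, intervalIntegral.intervalIntegral_eq_integral_uIoc, Pi.smul_apply,
      Complex.ofReal_add]
    rfl
  have hi3 : IntervalIntegrable (fun t : ℝ ↦ Pb (y₂ + t) - Pb (y₁ + t)) volume 0 h :=
    ((hPbc.comp (continuous_const.add continuous_id)).sub
      (hPbc.comp (continuous_const.add continuous_id))).intervalIntegrable _ _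
  have hi4 : IntervalIntegrable (fun t : ℝ ↦ Pa (y₂ + t) - Pa (y₁ + t)) volume 0 h :=
    ((hPac.comp (continuous_const.add continuous_id)).sub
      (hPac.comp (continuous_const.add continuous_id))).intervalIntegrable _ _
  -- the rectangle identity for `G` at height shift `t`
  have hrect : ∀ t : ℝ, H (y₁ + t) - H (y₂ + t) + I • (Pb (y₂ + t) - Pb (y₁ + t)) -
      I • (Pa (y₂ + t) - Pa (y₁ + t)) = 0 := by
    intro t
    have hr := rect_ext_eq_zero hD hmaj htr a b (y₁ + t) (y₂ + t)
    have hsb : ∫ s in (y₁ + t)..(y₂ + t), G (b + s * I) = Pb (y₂ + t) - Pb (y₁ + t) :=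
      (intervalIntegral.integral_interval_sub_left (intervalIntegrable_vertical hD hmaj b 0 _)
        (intervalIntegrable_vertical hD hmaj b 0 _)).symm
    have hsa : ∫ s in (y₁ + t)..(y₂ + t), G (a + s * I) = Pa (y₂ + t) - Pa (y₁ + t) :=
      (intervalIntegral.integral_interval_sub_left (intervalIntegrable_vertical hD hmaj a 0 _)
        (intervalIntegrable_vertical hD hmaj a 0 _)).symm
    rw [hsb, hsa] at hr
    exact hr
  have h12 : IntervalIntegrable (fun t : ℝ ↦ H (y₁ + t) - H (y₂ + t)) volume 0 h :=
    (hHint y₁).sub (hHint y₂)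
  have hi3' : IntervalIntegrable (fun t : ℝ ↦ I • (Pb (y₂ + t) - Pb (y₁ + t))) volume 0 h :=
    hi3.smul I
  have hi4' : IntervalIntegrable (fun t : ℝ ↦ I • (Pa (y₂ + t) - Pa (y₁ + t))) volume 0 h :=
    hi4.smul I
  have h123 : IntervalIntegrable
      (fun t : ℝ ↦ H (y₁ + t) - H (y₂ + t) + I • (Pb (y₂ + t) - Pb (y₁ + t))) volume 0 h :=
    h12.add hi3'
  have hcomb : ∫ t in (0 : ℝ)..h,
      (H (y₁ + t) - H (y₂ + t) + I • (Pb (y₂ + t) - Pb (y₁ + t)) - I • (Pa (y₂ + t) - Pa (y₁ + t))) =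
      (∫ t in (0 : ℝ)..h, H (y₁ + t)) - (∫ t in (0 : ℝ)..h, H (y₂ + t)) +
        I • (∫ t in (0 : ℝ)..h, (Pb (y₂ + t) - Pb (y₁ + t))) -
        I • (∫ t in (0 : ℝ)..h, (Pa (y₂ + t) - Pa (y₁ + t))) := by
    rw [intervalIntegral.integral_sub h123 hi4', intervalIntegral.integral_add h12 hi3',
      intervalIntegral.integral_sub (hHint y₁) (hHint y₂), intervalIntegral.integral_smul,
      intervalIntegral.integral_smul]
  rw [e1, e2, e3, e4, ← hcomb, intervalIntegral.integral_congr (g := fun _ ↦ (0 : ℂ))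
    (fun t _ ↦ hrect t), intervalIntegral.integral_zero]

/-- **Boundary uniqueness for `L¹_loc` traces on the upper half-plane.** If `D` is holomorphic on
`{Im z > 0}`, locally majorised by `C(1 + y^{−1/2})` near the real line, and its traces tend to
zero in `L¹_loc(ℝ)` (`∫_a^b ‖D(x+iy)‖dx → 0` as `y ↓ 0` for all `a, b`), then `D ≡ 0` on the upper
half-plane. (The vertical averages of the zero extension are entire by Morera and vanish below the
line `Im = −h`.) [cite: Rudin1987, Thm. 16.8] -/
theorem eq_zero_of_trace_tendsto_zero (hD : DifferentiableOn ℂ D {z : ℂ | 0 < z.im})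
    (hmaj : ∀ a b Y : ℝ, ∃ C : ℝ, ∀ x ∈ Icc a b, ∀ y : ℝ, 0 < y → y ≤ Y →
      ‖D (x + y * I)‖ ≤ C * (1 + y ^ (-(1 / 2 : ℝ))))
    (htr : ∀ a b : ℝ, Tendsto (fun y : ℝ ↦ ∫ x in a..b, ‖D (x + y * I)‖) (𝓝[>] 0) (𝓝 0))
    {w : ℂ} (hw : 0 < w.im) : D w = 0 := by
  set G : ℂ → ℂ := {z : ℂ | 0 < z.im}.indicator D with hG
  -- `A_h ≡ 0` for every `h > 0`
  have hA0 : ∀ h : ℝ, 0 < h → ∀ z : ℂ, ∫ t in (0 : ℝ)..h, G (z + t * I) = 0 := by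
    intro h hh
    set A : ℂ → ℂ := fun z ↦ ∫ t in (0 : ℝ)..h, G (z + t * I) with hA
    have hAc : Continuous A := continuous_verticalAverage hD hmaj h
    have hAcons : Complex.IsConservativeOn A univ := isConservativeOn_verticalAverage hD hmaj htr h
    have hAdiff : Differentiable ℂ A := differentiableOn_univ.1
      ((hAcons.isExactOn_univ hAc).differentiableOn isOpen_univ)
    -- `A = 0` on `{Im z < −h}`
    have hbelow : ∀ z : ℂ, z.im < -h → A z = 0 := by
      intro z hz
      have hcongr : EqOn (fun t : ℝ ↦ G (z + t * I)) (fun _ ↦ (0 : ℂ)) (uIcc 0 h) := by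
        intro t ht
        rw [uIcc_of_le hh.le] at ht
        exact ext_of_nonpos (by simp; linarith [ht.2])
      show (∫ t in (0 : ℝ)..h, G (z + t * I)) = 0
      rw [intervalIntegral.integral_congr hcongr, intervalIntegral.integral_zero]
    have han : AnalyticOnNhd ℂ A univ := fun z _ ↦ hAdiff.analyticAt z
    have hev : A =ᶠ[𝓝 (-((h + 1 : ℝ) : ℂ) * I)] 0 := by
      have hopen : IsOpen {z : ℂ | z.im < -h} := isOpen_lt Complex.continuous_im continuous_const
      have hmem : (-((h + 1 : ℝ) : ℂ) * I) ∈ {z : ℂ | z.im < -h} := by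
        show (-((h + 1 : ℝ) : ℂ) * I).im < -h
        simp
      filter_upwards [hopen.mem_nhds hmem] with z hz
      exact hbelow z hz
    intro z
    exact han.eqOn_zero_of_preconnected_of_eventuallyEq_zero isPreconnected_univ (mem_univ _) hev
      (mem_univ z)
  -- `D(w) = d/dh ∫₀ʰ G(z + it) dt` at `h₀ = Im w / 2`, `z = w − i h₀`
  set h₀ : ℝ := w.im / 2 with hh₀
  have hh₀pos : 0 < h₀ := by rw [hh₀]; linarith
  set z : ℂ := w - h₀ * I with hz
  have hzim : z.im = w.im / 2 := by
    have : z.im = w.im - h₀ := by rw [hz]; simp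
    rw [this, hh₀]; ring
  have hpath : ∀ t : ℝ, 0 < t → 0 < (z + t * I).im := fun t ht ↦ by simp [hzim]; linarith
  set g : ℝ → ℂ := fun u ↦ ∫ t in (0 : ℝ)..u, G (z + t * I) with hg
  have hg0 : ∀ u : ℝ, 0 < u → g u = 0 := fun u hu ↦ hA0 u hu z
  -- FTC at `h₀`
  have hGm : Measurable G := measurable_ext hD
  have hcontG : ContinuousAt (fun t : ℝ ↦ G (z + t * I)) h₀ := by
    have hopen : IsOpen {z : ℂ | 0 < z.im} := isOpen_lt continuous_const Complex.continuous_im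
    have hmem : z + h₀ * I ∈ {z : ℂ | 0 < z.im} := hpath h₀ hh₀pos
    have hDc : ContinuousAt D (z + h₀ * I) := (hD.differentiableAt (hopen.mem_nhds hmem)).continuousAt
    have hGc : ContinuousAt G (z + h₀ * I) := by
      refine hDc.congr_of_eventuallyEq ?_
      filter_upwards [hopen.mem_nhds hmem] with v hv
      exact ext_of_pos hv
    exact ContinuousAt.comp (f := fun t : ℝ ↦ z + t * I) hGc (Continuous.continuousAt (by fun_prop))
  have hint : IntervalIntegrable (fun t : ℝ ↦ G (z + t * I)) volume 0 h₀ := by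
    have := intervalIntegrable_vertical hD hmaj z.re z.im (z.im + h₀)
    have e : (fun t : ℝ ↦ G (z + t * I)) = fun t ↦ (fun σ : ℝ ↦ G (z.re + σ * I)) (t + z.im) := by
      funext t
      have hz' : z = (z.re : ℂ) + z.im * I := (Complex.re_add_im z).symm
      conv_lhs => rw [hz']
      congr 1; push_cast; ring
    rw [e]
    have h2 := this.comp_add_right z.im
    simpa using h2
  have hderiv : HasDerivAt g (G (z + h₀ * I)) h₀ :=
    intervalIntegral.integral_hasDerivAt_right hint
      ((hGm.comp (by fun_prop : Measurable fun t : ℝ ↦ z + t * I)).aestronglyMeasurable.stronglyMeasurableAtFilter)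
      hcontG
  have hderiv0 : HasDerivAt g 0 h₀ := by
    refine (hasDerivAt_const h₀ (0 : ℂ)).congr_of_eventuallyEq ?_
    filter_upwards [Ioi_mem_nhds hh₀pos] with u hu
    exact hg0 u hu
  have hGw : G (z + h₀ * I) = 0 := hderiv.unique hderiv0
  have hzw : z + h₀ * I = w := by rw [hz]; ring
  rw [hzw] at hGw
  have hDG : D w = G w := by rw [hG]; exact (ext_of_pos hw).symm
  rw [hDG]
  exact hGw

end Uniqueness

end Literature.Analysis.DeBrangesSpaces
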